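import Literature.NumberTheory.GaloisRepresentations.LubinTateColemanRelativeMomentLogCoordinateTwo
import Literature.NumberTheory.EllipticCurves.FormalGroupLubinTateLogarithmDegreeOnePadic
import Literature.NumberTheory.EllipticCurves.DeShalitThetaTExpansionMoments
import Literature.NumberTheory.GaloisRepresentations.LubinTateColemanRelativeCoatesWilesTwo
import Literature.NumberTheory.GaloisRepresentations.LubinTateSubstChainValues
import HarnessLib

/-!
# The PER-UNIT hypothesis `hX` of the `j = 0` seam identity FROM THE BRIDGE IDENTITY: if the relative Coleman series of a unit `β` is
# `(G ∘ [1]_{P′,f}) ∘ [a]_f` with `G` the theta `t`-expansion read `𝔓`-adically, then `ρ(c_β) = φ_F(a)^{k+1} · ι⁻¹(−12·E_{k+1}(Ω; L, 𝔞))`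
# (de Shalit II §4.9–4.10 (26), assembled from the moment identification; proofs only)

Cell `bsd-print-cf2`, width seat `bsd-line-cf2-p1-w2` g24 (piece (β) of the per-unit assembler); `--supports` the print leaf
stmt-BirchSwinnertonDyer-24720 (helper, Theses-free).  THEOREMS ONLY; no `def`, no named fact, no `sorry`.

This file composes, ONCE AND FOR ALL, the four moment-identification files of this seat
(`LubinTateColemanRelativeMomentLogCoordinateTwo` §3 · `FormalGroupLubinTateLogarithmDegreeOnePadic` · `DeShalitThetaTExpansionMoments` §1/§2)
into the shape `hX` consumed by `Theorems/PrintCf2RubinValueTwoKatzMeasureJZeroSeamIdentity.twist_mul_integral_eq_of_perUnit`: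
for a relative norm-coherent unit `β ∈ 𝒰_E` of the measure lane at `K_v` (`v ∣ 2` of degree one), READ in `ℂ₂` through a ring map
`ρ : 𝒪_E → ℂ₂` over `φ_F : K_v → ℂ₂` (the lane's `Θ ∘ j_m`), GIVEN
(hβ) the BRIDGE identity `g_β = (G ∘ [1]_{P′,f}) ∘ [a]_f` in the output shape of `relColemanSeries_eq_subst_subst_of_forall_evS` (cf2c-w4; its
hypothesis = the pointwise value identity, piece (α), + the fifth print), with `P′ = P.map (LTCoeff.of ∘ e⁻¹)` the transported `ℤ₂`-series of
`cm7Padic_exists_formalGroupLaw_eq_ltF` (`hP`: `P ↦ exp_W(c·log_W)`, `e (u·2) = c`),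
(hG) `G = Q_R^{ψ_𝔓}` for the algebraic theta `t`-expansion `Q_R` over a ring `R` carrying de Shalit's data (`x₀, y₀, x_c, K`; seat g13) and
`ψ_𝔓 : R → 𝒪_E`, with the complex reading `φ_ℂ : R → ℂ` of g13 (`hS h₂ h₃ hΩ hV ha hb hK hx hu`),
(hQθ) the COMPATIBILITY `ρ ∘ ψ_𝔓 = ι⁻¹ ∘ φ_ℂ` of the two readings (the frame's `θ` vs `ι : ℚ̄₂ ≃ ℂ`; the packager's choice R-QO), and
(hW) the model identity `(W_R^{φ_ℂ})^{ι⁻¹} = (V^{eK⁻¹∘Coe})^{φ_F}` (both `[1,−1,0,−2,−1]` at DA7),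
THEN ★★★ `map_relCoatesWiles_eq_of_bridge`:
**`ρ(c_β) = φ_F(a)^{k+1} · ι⁻¹(−12·(#S·E_{k+1}(Ω, L) − E_{k+1}(Ω, L′)))`**, `c_β = [X⁰] D_E^[k] (δ_E g_β)` — i.e. `hX` with `A := φ_F(a)^{k+1}`,
`E₀ := E_{k+1}(Ω, L)`, `E(𝔟) := E_{k+1}(Ω, 𝔟⁻¹L)` (`#S = N𝔟`).  HONEST FRAMING: an assembly of accepted kernel theorems; the hypotheses
(hβ), (hG), (hQθ), (hW) are named, not discharged; nothing closes a crux; no summit statement is proved; BSD is not proved by any of this.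

## References
* [deShalit1987] E. de Shalit, *Iwasawa theory of elliptic curves with complex multiplication* (1987), II §4.9 (i)(ii) (p. 62–63), II §4.10 (26) (p. 64),
  II §4.14 (38)–(40) (p. 71–72).
-/

-- the summit namespace `Summit.BirchSwinnertonDyer.BirchSwinnertonDyer` repeats the problem name by design (D-0017)
set_option linter.dupNamespace false
set_option autoImplicit false

noncomputable section

open scoped Classical
open PowerSeries IsDedekindDomain NumberField ValuativeRel Field PeriodPair
open Literature.NumberTheory.NumberFields Literature.NumberTheory.EllipticCurves
open Literature.NumberTheory.GaloisRepresentations Literature.NumberTheory.GaloisRepresentations.IsNonarchimedeanLocalField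
  Literature.NumberTheory.GaloisRepresentations.LubinTate

namespace Summit.BirchSwinnertonDyer.BirchSwinnertonDyer.Theorems.PrintCf2.KatzMeasureJZeroSeam

attribute [local instance] ltNormUniformSpace ltNormIsUniformAddGroup rk1 nF nE fintypeResidueField

variable (K : Type) [Field K] [NumberField K] (v : HeightOneSpectrum (𝓞 K)) [v.asIdeal.LiesOver (ratPlace 2).asIdeal]
  (he : v.asIdeal.ramificationIdx (𝓞 ℚ) = 1) (hf : v.asIdeal.inertiaDeg (𝓞 ℚ) = 1)

set_option maxHeartbeats 1600000 in
/-- ★★★ **`hX` FROM THE BRIDGE** (de Shalit II §4.10 (26) assembled): see the module docstring for the hypotheses (hβ), (hG), (hQθ), (hW).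
Conclusion: `ρ([X⁰] D_E^[k] (δ_E g_β)) = φ_F(a)^{k+1} · ι⁻¹(−12·(#S·E_{k+1}(Ω, L) − E_{k+1}(Ω, L′)))`.
[cite: deShalit1987, II §4.9 Proposition (i)(ii) (p. 62–63), II §4.10 (26) (p. 64)] -/
theorem map_relCoatesWiles_eq_of_bridge
    -- the local datum of the lane at `F = K_v`
    (hq : residueFieldCard (v.adicCompletion K) = 2)
    (h2 : (valuation (v.adicCompletion K)).IsUniformizer ((((2 : ℕ) : 𝒪[v.adicCompletion K]) : v.adicCompletion K)))
    (u : 𝒪[v.adicCompletion K]ˣ)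
    (E : IntermediateField (v.adicCompletion K) (AlgebraicClosure (v.adicCompletion K)))
    [FiniteDimensional (v.adicCompletion K) E] [Normal (v.adicCompletion K) E] [IsGalois (v.adicCompletion K) E]
    (hE : E ≤ maxUnramified (v.adicCompletion K))
    {σ₀ : absoluteGaloisGroup (v.adicCompletion K)} (hσ₀ : IsAbsArithFrob σ₀)
    (β : RelNormCoherentUnits (isUniformizer_unit_mul h2 u) E) (k : ℕ)
    -- the readings: `ρ = Θ ∘ j` on `𝒪_E` over `φ_F` on `K_v`, and `ι : ℚ̄₂ ≃ ℂ`
    (ρ : unitBall E →+* ℂ_[2]) (φF : v.adicCompletion K →+* ℂ_[2])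
    (hρ : ρ.comp (algebraMap (LTCoeff (v.adicCompletion K)) (unitBall E)) =
      φF.comp ((algebraMap 𝒪[v.adicCompletion K] (v.adicCompletion K)).comp (LTCoeff.of (v.adicCompletion K)).symm.toRingHom))
    (ιp : PadicAlgCl 2 ≃+* ℂ)
    -- the `ℤ₂`-datum of the curve (`cm7Padic_exists_formalGroupLaw_eq_ltF`) transported along `e`
    (V : WeierstrassCurve ℤ_[2]) {c : ℤ_[2]} {P : PowerSeries ℤ_[2]}
    (hP : P.map PadicInt.Coe.ringHom =
      (V.map PadicInt.Coe.ringHom).formalExp.subst (C (c : ℚ_[2]) * (V.map PadicInt.Coe.ringHom).formalLog))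
    (heπ : ((integerEquivAdicCompletionIntegers v).trans (padicIntEquivOfDegreeOne K 2 v he hf))
      ((u : 𝒪[v.adicCompletion K]) * ((2 : ℕ) : 𝒪[v.adicCompletion K])) = c)
    (hP' : IsLTSeries (LTCoeff.of (v.adicCompletion K) ((u : 𝒪[v.adicCompletion K]) * ((2 : ℕ) : 𝒪[v.adicCompletion K])))
      (residueFieldCard (v.adicCompletion K))
      (P.map ((LTCoeff.of (v.adicCompletion K)).toRingHom.comp
        ((integerEquivAdicCompletionIntegers v).trans (padicIntEquivOfDegreeOne K 2 v he hf)).symm.toRingHom)))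
    -- the bridge identity (α)+(RC): `g_β = (G ∘ [1]_{P′,f}) ∘ [a]_f`
    (a : LTCoeff (v.adicCompletion K)) (G : (PowerSeries (unitBall E))ˣ)
    (hβ : relColemanSeries (isUniformizer_unit_mul h2 u) E hq hE hσ₀ β =
      PowerSeries.subst ((hom (isLTRing_LTCoeff (isUniformizer_unit_mul h2 u)) (isLTSeries_LTCoeff _) (isLTSeries_LTCoeff _) a).map
          (algebraMap (LTCoeff (v.adicCompletion K)) (unitBall E)))
        (PowerSeries.subst ((hom (isLTRing_LTCoeff (isUniformizer_unit_mul h2 u)) hP' (isLTSeries_LTCoeff _) 1).map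
          (algebraMap (LTCoeff (v.adicCompletion K)) (unitBall E))) (G : PowerSeries (unitBall E))))
    -- the theta `t`-expansion over `R`, its `𝔓`-adic and complex readings (g13's setting verbatim)
    {R : Type*} [CommRing R] (WR : WeierstrassCurve R) (x₀ y₀ : R) (x : ℂ → R) (uc : ℂ → Rˣ) (Kc : R) (φC : R →+* ℂ)
    (WC : WeierstrassCurve ℂ) (L : PeriodPair) {L' : PeriodPair} {S : Finset ℂ} {Ω : ℂ}
    (hS : L.IsLatticeReps L' S) (hg₂ : L.g₂ = WC.c₄ / 12) (hg₃ : L.g₃ = WC.c₆ / 216) (hΩ : Ω ∉ L'.lattice) (hV : WR.map φC = WC)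
    (ha : φC x₀ = ℘[L] Ω - WC.b₂ / 12) (hb : φC y₀ = (℘'[L] Ω - WC.a₁ * (℘[L] Ω - WC.b₂ / 12) - WC.a₃) / 2)
    (hK : φC Kc = L.deltaRatio L' * (L.g₂ ^ 3 - 27 * L.g₃ ^ 2) ^ (S.card - 1))
    (hx : ∀ c ∈ S.erase 0, φC (x c) = ℘[L] c - WC.b₂ / 12) (hu : ∀ c ∈ S.erase 0, (uc c : R) = x₀ - x c)
    (ψ𝔓 : R →+* unitBall E)
    (hG : (G : PowerSeries (unitBall E)) = PowerSeries.map ψ𝔓 (C Kc * ∏ c ∈ S.erase 0,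
        PowerSeries.invOfUnit ((WR.translateX x₀ y₀).subst WR.formalNeg - C (x c)) (uc c) ^ 6))
    (hQθ : ρ.comp ψ𝔓 = ((algebraMap (PadicAlgCl 2) ℂ_[2]).comp ιp.symm.toRingHom).comp φC)
    (hW : (WR.map φC).map ((algebraMap (PadicAlgCl 2) ℂ_[2]).comp ιp.symm.toRingHom) =
      (V.map (((padicEquivOfDegreeOne K 2 v he hf).symm.toRingHom).comp (PadicInt.Coe.ringHom (p := 2)))).map φF) :
    ρ (PowerSeries.constantCoeff ((fun g : PowerSeries (unitBall E) =>
        (invDiff (isLTRing_LTCoeff (isUniformizer_unit_mul h2 u))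
            (isLTSeries_LTCoeff ((u : 𝒪[v.adicCompletion K]) * ((2 : ℕ) : 𝒪[v.adicCompletion K])))).map
            (algebraMap (LTCoeff (v.adicCompletion K)) (unitBall E)) *
          PowerSeries.derivative (unitBall E) g)^[k] (relLogDerivSeries (isUniformizer_unit_mul h2 u) E hq hE hσ₀ β))) =
      (φF (((LTCoeff.of (v.adicCompletion K)).symm a : 𝒪[v.adicCompletion K]) : v.adicCompletion K)) ^ (k + 1) *
        ((ιp.symm (-12 * ((S.card : ℂ) * L.eisensteinE (k + 1) Ω - L'.eisensteinE (k + 1) Ω)) : PadicAlgCl 2) : ℂ_[2]) := by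
  -- `ℂ₂` as a `K_v`-algebra through `φ_F`
  letI : Algebra (v.adicCompletion K) ℂ_[2] := φF.toAlgebra
  have halg : algebraMap (v.adicCompletion K) ℂ_[2] = φF := rfl
  set τ : ℂ →+* ℂ_[2] := (algebraMap (PadicAlgCl 2) ℂ_[2]).comp ιp.symm.toRingHom with hτ
  have hτapp : ∀ z : ℂ, ((ιp.symm z : PadicAlgCl 2) : ℂ_[2]) = τ z := fun z ↦ rfl
  -- the curve over `ℂ₂` and its logarithm
  set W₂ : WeierstrassCurve ℂ_[2] :=
    (V.map (((padicEquivOfDegreeOne K 2 v he hf).symm.toRingHom).comp (PadicInt.Coe.ringHom (p := 2)))).map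
      (algebraMap (v.adicCompletion K) ℂ_[2]) with hW₂
  have hΛ0 : PowerSeries.constantCoeff W₂.formalLog = 0 := W₂.constantCoeff_formalLog
  have hΛ1 : IsUnit (PowerSeries.coeff 1 W₂.formalLog) := W₂.isUnit_coeff_one_formalLog
  -- (MI-1d) the logarithm-compatibility of the change of variable `[1]_{P′,f} ∘ [a]_f`
  have hcompat := formalLog_map_subst_map_subst_hom_eq_of_degree_one K 2 v he hf V hP (isUniformizer_unit_mul h2 u) heπ hP'
    (B := ℂ_[2]) a
  -- the unit `Ge = (G^ρ) ∘ exp_{W₂}` and its identification with the complex Taylor series read through `τ`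
  have hse : PowerSeries.HasSubst (W₂.formalLog.substInvOfIsUnit hΛ1) :=
    PowerSeries.HasSubst.of_constantCoeff_zero' (PowerSeries.constantCoeff_substInvOfIsUnit _ hΛ1)
  let Ge : (PowerSeries ℂ_[2])ˣ := Units.map (PowerSeries.substAlgHom hse : PowerSeries ℂ_[2] →ₐ[ℂ_[2]] PowerSeries ℂ_[2]).toMonoidHom
    (Units.map (PowerSeries.map ρ).toMonoidHom G)
  have hGe : (Ge : PowerSeries ℂ_[2]) = ((G : PowerSeries (unitBall E)).map ρ).subst (W₂.formalLog.substInvOfIsUnit hΛ1) := by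
    change PowerSeries.substAlgHom hse (PowerSeries.map ρ (G : PowerSeries (unitBall E))) = _
    rw [PowerSeries.coe_substAlgHom]
  -- (MI-1 §3) the Coates–Wiles value through `ρ`
  have hMI := map_constantCoeff_iterate_relDerivation_relLogDerivSeries_of_eq_subst_subst (isUniformizer_unit_mul h2 u) E hq hE hσ₀
    (B := ℂ_[2]) ρ (by rw [hρ, halg]) β k G (constantCoeff_hom _ _ _ _) (constantCoeff_hom _ _ _ _) hβ hΛ0 hΛ1
    (b := φF (((LTCoeff.of (v.adicCompletion K)).symm a : 𝒪[v.adicCompletion K]) : v.adicCompletion K))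
    (by rw [halg] at hcompat; rw [hρ]; exact hcompat) Ge hGe
  rw [hMI]
  -- the complex unit `Pe = (Q_R^{φ_ℂ}) ∘ exp_{W_ℂ} = P`, the Taylor series of `Θ(Ω − z; L, L′, S)`
  set QC : PowerSeries ℂ := PowerSeries.map φC (C Kc * ∏ c ∈ S.erase 0,
    PowerSeries.invOfUnit ((WR.translateX x₀ y₀).subst WR.formalNeg - C (x c)) (uc c) ^ 6) with hQC
  have hPtaylor : (PowerSeries.mk fun n => ((Nat.factorial n : ℂ))⁻¹ * iteratedDeriv n (fun w => L.deShalitTheta L' S (Ω - w)) 0) =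
      QC.subst WC.formalExp :=
    WR.taylor_deShalitTheta_sub_eq_map_subst_formalExp x₀ y₀ x uc Kc φC WC L hS hg₂ hg₃ hΩ hV ha hb hK hx hu
  have hPe_unit : IsUnit (QC.subst WC.formalExp) := by
    rw [PowerSeries.isUnit_iff_constantCoeff, ← hPtaylor]
    exact (PeriodPair.constantCoeff_taylor_deShalitTheta_ne_zero hS hΩ).isUnit
  have hQC0 : PowerSeries.constantCoeff QC ≠ 0 := by
    rw [hQC, ← PowerSeries.coeff_zero_eq_constantCoeff_apply, PowerSeries.coeff_map, PowerSeries.coeff_zero_eq_constantCoeff_apply,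
      WR.map_constantCoeff_thetaTExpansion_eq_deShalitTheta x₀ y₀ x uc Kc φC WC L ha hK hx hu]
    exact PeriodPair.deShalitTheta_ne_zero hS hΩ
  have hQC_unit : IsUnit QC := PowerSeries.isUnit_iff_constantCoeff.mpr hQC0.isUnit
  -- functoriality (MI-2 §1) along `τ : ℂ → ℂ₂`: `Ge = (QC-unit)^τ ∘ exp_{W_ℂ^τ}`
  have hGmap : (G : PowerSeries (unitBall E)).map ρ = QC.map τ := by
    rw [hG, ← RingHom.comp_apply (PowerSeries.map ρ) (PowerSeries.map ψ𝔓), ← PowerSeries.map_comp, hQθ, hQC,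
      ← RingHom.comp_apply (PowerSeries.map τ) (PowerSeries.map φC), ← PowerSeries.map_comp]
  have hW₂ : WC.map τ = W₂ := by rw [← hV, hW, hW₂, halg]
  have hGe' : (Ge : PowerSeries ℂ_[2]) =
      PowerSeries.subst (WC.map τ).formalExp (PowerSeries.map τ ((hQC_unit.unit : (PowerSeries ℂ)ˣ) : PowerSeries ℂ)) := by
    rw [hGe, hGmap, IsUnit.unit_spec, hW₂, WeierstrassCurve.formalExp_eq_substInvOfIsUnit]
  have hfun := WeierstrassCurve.factorial_mul_coeff_dlog_units_subst_formalExp_map τ WC hQC_unit.unit hPe_unit.unit Ge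
    (by rw [IsUnit.unit_spec, IsUnit.unit_spec]) hGe' k
  have hval := WR.factorial_mul_coeff_dlog_units_map_thetaTExpansion_subst_formalExp x₀ y₀ x uc Kc φC WC L hS hg₂ hg₃ hΩ hV ha hb
    hK hx hu hPe_unit.unit (by rw [IsUnit.unit_spec]) k
  rw [hτapp]
  calc (k.factorial : ℂ_[2]) * (φF (((LTCoeff.of (v.adicCompletion K)).symm a : 𝒪[v.adicCompletion K]) : v.adicCompletion K) ^ (k + 1) *
        PowerSeries.coeff k (PowerSeries.dlog Ge))
      = φF (((LTCoeff.of (v.adicCompletion K)).symm a : 𝒪[v.adicCompletion K]) : v.adicCompletion K) ^ (k + 1) *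
          ((k.factorial : ℂ_[2]) * PowerSeries.coeff k (PowerSeries.dlog Ge)) := by ring
    _ = φF (((LTCoeff.of (v.adicCompletion K)).symm a : 𝒪[v.adicCompletion K]) : v.adicCompletion K) ^ (k + 1) *
          τ (-12 * ((S.card : ℂ) * L.eisensteinE (k + 1) Ω - L'.eisensteinE (k + 1) Ω)) := by rw [hfun, hval]

/-! ## Appended (g24, piece (γ)): the GENERIC-unit form and the FROBENIUS IMAGE `φ(c_β)`

de Shalit II §4.14 (38)→(40) needs, besides `c_β` (per-unit `hX`, above), the Frobenius images `φ(c_β)` (per-unit `hΦ`).  `D_E`, `δ_E`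
commute with `φ` (`map_frob_iterate_relDerivation`, `relLogDeriv_map`) and `φ` fixes `[1]_{P′,f}`, `[a]_f` (`map_subst_map_algebraMap_of_comp_eq`),
so `φ(c_β)` is the Coates–Wiles value of `g_β^φ = (G^φ ∘ [1]_{P′,f}) ∘ [a]_f`; the GENERIC-unit form `map_constantCoeff_iterate_dlog_eq_of_bridge`
(any unit `G_β = (G ∘ [1]_{P′,f}) ∘ [a]_f` of `𝒪_E⟦X⟧`) gives both, and (γ) `map_frob_relCoatesWiles_eq_of_bridge` reads:
GIVEN (hβ) as above and (hGφ) `G^φ = Q_{R}^{ψ_𝔓}` for theta data `(x₀, y₀, x_c, K; L, L′, S, Ω)` (the CONJUGATE data: on the (α) side this is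
de Shalit II §2.5 (15)(vii), `prop15_grossencharacterReciprocity`, with g13's `map_thetaTExpansion`), THEN
`ρ(φ(c_β)) = φ_F(a)^{k+1} · ι⁻¹(−12·(#S·E_{k+1}(Ω, L) − E_{k+1}(Ω, L′)))`.  Proofs only; hypotheses named, not discharged. -/

set_option maxHeartbeats 1600000 in
/-- ★★★ **GENERIC-UNIT FORM of `map_relCoatesWiles_eq_of_bridge`**: for ANY unit `G_β` of `𝒪_E⟦X⟧` with `G_β = (G ∘ [1]_{P′,f}) ∘ [a]_f`
(hGβ) and `G = Q_R^{ψ_𝔓}` (hG), under (hQθ), (hW): `ρ([X⁰] D_E^[k] (ω·dlog G_β)) = φ_F(a)^{k+1} · ι⁻¹(−12·(#S·E_{k+1}(Ω, L) − E_{k+1}(Ω, L′)))`.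
[cite: deShalit1987, II §4.9 Proposition (i)(ii) (p. 62–63), II §4.10 (26) (p. 64)] -/
theorem map_constantCoeff_iterate_dlog_eq_of_bridge
    (h2 : (valuation (v.adicCompletion K)).IsUniformizer ((((2 : ℕ) : 𝒪[v.adicCompletion K]) : v.adicCompletion K)))
    (u : 𝒪[v.adicCompletion K]ˣ)
    (E : IntermediateField (v.adicCompletion K) (AlgebraicClosure (v.adicCompletion K)))
    [FiniteDimensional (v.adicCompletion K) E] (k : ℕ)
    (ρ : unitBall E →+* ℂ_[2]) (φF : v.adicCompletion K →+* ℂ_[2])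
    (hρ : ρ.comp (algebraMap (LTCoeff (v.adicCompletion K)) (unitBall E)) =
      φF.comp ((algebraMap 𝒪[v.adicCompletion K] (v.adicCompletion K)).comp (LTCoeff.of (v.adicCompletion K)).symm.toRingHom))
    (ιp : PadicAlgCl 2 ≃+* ℂ)
    (V : WeierstrassCurve ℤ_[2]) {c : ℤ_[2]} {P : PowerSeries ℤ_[2]}
    (hP : P.map PadicInt.Coe.ringHom =
      (V.map PadicInt.Coe.ringHom).formalExp.subst (C (c : ℚ_[2]) * (V.map PadicInt.Coe.ringHom).formalLog))
    (heπ : ((integerEquivAdicCompletionIntegers v).trans (padicIntEquivOfDegreeOne K 2 v he hf))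
      ((u : 𝒪[v.adicCompletion K]) * ((2 : ℕ) : 𝒪[v.adicCompletion K])) = c)
    (hP' : IsLTSeries (LTCoeff.of (v.adicCompletion K) ((u : 𝒪[v.adicCompletion K]) * ((2 : ℕ) : 𝒪[v.adicCompletion K])))
      (residueFieldCard (v.adicCompletion K))
      (P.map ((LTCoeff.of (v.adicCompletion K)).toRingHom.comp
        ((integerEquivAdicCompletionIntegers v).trans (padicIntEquivOfDegreeOne K 2 v he hf)).symm.toRingHom)))
    (a : LTCoeff (v.adicCompletion K)) (Gβ G : (PowerSeries (unitBall E))ˣ)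
    (hGβ : (Gβ : PowerSeries (unitBall E)) =
      PowerSeries.subst ((hom (isLTRing_LTCoeff (isUniformizer_unit_mul h2 u)) (isLTSeries_LTCoeff _) (isLTSeries_LTCoeff _) a).map
          (algebraMap (LTCoeff (v.adicCompletion K)) (unitBall E)))
        (PowerSeries.subst ((hom (isLTRing_LTCoeff (isUniformizer_unit_mul h2 u)) hP' (isLTSeries_LTCoeff _) 1).map
          (algebraMap (LTCoeff (v.adicCompletion K)) (unitBall E))) (G : PowerSeries (unitBall E))))
    {R : Type*} [CommRing R] (WR : WeierstrassCurve R) (x₀ y₀ : R) (x : ℂ → R) (uc : ℂ → Rˣ) (Kc : R) (φC : R →+* ℂ)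
    (WC : WeierstrassCurve ℂ) (L : PeriodPair) {L' : PeriodPair} {S : Finset ℂ} {Ω : ℂ}
    (hS : L.IsLatticeReps L' S) (hg₂ : L.g₂ = WC.c₄ / 12) (hg₃ : L.g₃ = WC.c₆ / 216) (hΩ : Ω ∉ L'.lattice) (hV : WR.map φC = WC)
    (ha : φC x₀ = ℘[L] Ω - WC.b₂ / 12) (hb : φC y₀ = (℘'[L] Ω - WC.a₁ * (℘[L] Ω - WC.b₂ / 12) - WC.a₃) / 2)
    (hK : φC Kc = L.deltaRatio L' * (L.g₂ ^ 3 - 27 * L.g₃ ^ 2) ^ (S.card - 1))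
    (hx : ∀ c ∈ S.erase 0, φC (x c) = ℘[L] c - WC.b₂ / 12) (hu : ∀ c ∈ S.erase 0, (uc c : R) = x₀ - x c)
    (ψ𝔓 : R →+* unitBall E)
    (hG : (G : PowerSeries (unitBall E)) = PowerSeries.map ψ𝔓 (C Kc * ∏ c ∈ S.erase 0,
        PowerSeries.invOfUnit ((WR.translateX x₀ y₀).subst WR.formalNeg - C (x c)) (uc c) ^ 6))
    (hQθ : ρ.comp ψ𝔓 = ((algebraMap (PadicAlgCl 2) ℂ_[2]).comp ιp.symm.toRingHom).comp φC)
    (hW : (WR.map φC).map ((algebraMap (PadicAlgCl 2) ℂ_[2]).comp ιp.symm.toRingHom) =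
      (V.map (((padicEquivOfDegreeOne K 2 v he hf).symm.toRingHom).comp (PadicInt.Coe.ringHom (p := 2)))).map φF) :
    ρ (PowerSeries.constantCoeff ((fun g : PowerSeries (unitBall E) =>
        (invDiff (isLTRing_LTCoeff (isUniformizer_unit_mul h2 u))
            (isLTSeries_LTCoeff ((u : 𝒪[v.adicCompletion K]) * ((2 : ℕ) : 𝒪[v.adicCompletion K])))).map
            (algebraMap (LTCoeff (v.adicCompletion K)) (unitBall E)) *
          PowerSeries.derivative (unitBall E) g)^[k]
        ((invDiff (isLTRing_LTCoeff (isUniformizer_unit_mul h2 u))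
            (isLTSeries_LTCoeff ((u : 𝒪[v.adicCompletion K]) * ((2 : ℕ) : 𝒪[v.adicCompletion K])))).map
            (algebraMap (LTCoeff (v.adicCompletion K)) (unitBall E)) * PowerSeries.dlog Gβ))) =
      (φF (((LTCoeff.of (v.adicCompletion K)).symm a : 𝒪[v.adicCompletion K]) : v.adicCompletion K)) ^ (k + 1) *
        ((ιp.symm (-12 * ((S.card : ℂ) * L.eisensteinE (k + 1) Ω - L'.eisensteinE (k + 1) Ω)) : PadicAlgCl 2) : ℂ_[2]) := by
  -- (same assembly as `map_relCoatesWiles_eq_of_bridge`, with MI-1 §2 in place of MI-1 §3)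
  letI : Algebra (v.adicCompletion K) ℂ_[2] := φF.toAlgebra
  have halg : algebraMap (v.adicCompletion K) ℂ_[2] = φF := rfl
  set τ : ℂ →+* ℂ_[2] := (algebraMap (PadicAlgCl 2) ℂ_[2]).comp ιp.symm.toRingHom with hτ
  have hτapp : ∀ z : ℂ, ((ιp.symm z : PadicAlgCl 2) : ℂ_[2]) = τ z := fun z ↦ rfl
  set W₂ : WeierstrassCurve ℂ_[2] :=
    (V.map (((padicEquivOfDegreeOne K 2 v he hf).symm.toRingHom).comp (PadicInt.Coe.ringHom (p := 2)))).map
      (algebraMap (v.adicCompletion K) ℂ_[2]) with hW₂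
  have hΛ0 : PowerSeries.constantCoeff W₂.formalLog = 0 := W₂.constantCoeff_formalLog
  have hΛ1 : IsUnit (PowerSeries.coeff 1 W₂.formalLog) := W₂.isUnit_coeff_one_formalLog
  have hcompat := formalLog_map_subst_map_subst_hom_eq_of_degree_one K 2 v he hf V hP (isUniformizer_unit_mul h2 u) heπ hP'
    (B := ℂ_[2]) a
  have hse : PowerSeries.HasSubst (W₂.formalLog.substInvOfIsUnit hΛ1) :=
    PowerSeries.HasSubst.of_constantCoeff_zero' (PowerSeries.constantCoeff_substInvOfIsUnit _ hΛ1)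
  let Ge : (PowerSeries ℂ_[2])ˣ := Units.map (PowerSeries.substAlgHom hse : PowerSeries ℂ_[2] →ₐ[ℂ_[2]] PowerSeries ℂ_[2]).toMonoidHom
    (Units.map (PowerSeries.map ρ).toMonoidHom G)
  have hGe : (Ge : PowerSeries ℂ_[2]) = ((G : PowerSeries (unitBall E)).map ρ).subst (W₂.formalLog.substInvOfIsUnit hΛ1) := by
    change PowerSeries.substAlgHom hse (PowerSeries.map ρ (G : PowerSeries (unitBall E))) = _
    rw [PowerSeries.coe_substAlgHom]
  -- one substitution `H = [1]_{P′,f} ∘ [a]_f` instead of two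
  have hH₂ : PowerSeries.constantCoeff
      (hom (isLTRing_LTCoeff (isUniformizer_unit_mul h2 u)) (isLTSeries_LTCoeff _) (isLTSeries_LTCoeff _) a) = 0 :=
    constantCoeff_hom _ _ _ _
  have hH₁ : PowerSeries.constantCoeff (hom (isLTRing_LTCoeff (isUniformizer_unit_mul h2 u)) hP' (isLTSeries_LTCoeff _) 1) = 0 :=
    constantCoeff_hom _ _ _ _
  have hs₁ : PowerSeries.HasSubst ((hom (isLTRing_LTCoeff (isUniformizer_unit_mul h2 u)) hP' (isLTSeries_LTCoeff _) 1).map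
      (algebraMap (LTCoeff (v.adicCompletion K)) (unitBall E))) :=
    PowerSeries.HasSubst.of_constantCoeff_zero'
    (by rw [← PowerSeries.coeff_zero_eq_constantCoeff_apply, PowerSeries.coeff_map,
      PowerSeries.coeff_zero_eq_constantCoeff_apply, hH₁, map_zero])
  have hs₂ : PowerSeries.HasSubst ((hom (isLTRing_LTCoeff (isUniformizer_unit_mul h2 u)) (isLTSeries_LTCoeff _)
      (isLTSeries_LTCoeff _) a).map (algebraMap (LTCoeff (v.adicCompletion K)) (unitBall E))) :=
    PowerSeries.HasSubst.of_constantCoeff_zero'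
    (by rw [← PowerSeries.coeff_zero_eq_constantCoeff_apply, PowerSeries.coeff_map,
      PowerSeries.coeff_zero_eq_constantCoeff_apply, hH₂, map_zero])
  have hH : PowerSeries.constantCoeff (PowerSeries.subst
      (hom (isLTRing_LTCoeff (isUniformizer_unit_mul h2 u)) (isLTSeries_LTCoeff _) (isLTSeries_LTCoeff _) a)
      (hom (isLTRing_LTCoeff (isUniformizer_unit_mul h2 u)) hP' (isLTSeries_LTCoeff _) 1)) = 0 :=
    PowerSeries.constantCoeff_subst_eq_zero hH₂ _ hH₁
  have hGβ' : (Gβ : PowerSeries (unitBall E)) = (G : PowerSeries (unitBall E)).subst (PowerSeries.map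
      (algebraMap (LTCoeff (v.adicCompletion K)) (unitBall E)) (PowerSeries.subst
      (hom (isLTRing_LTCoeff (isUniformizer_unit_mul h2 u)) (isLTSeries_LTCoeff _) (isLTSeries_LTCoeff _) a)
      (hom (isLTRing_LTCoeff (isUniformizer_unit_mul h2 u)) hP' (isLTSeries_LTCoeff _) 1))) := by
    rw [hGβ, PowerSeries.subst_comp_subst_apply hs₁ hs₂, map_subst₁F _ hH₂]
  -- (MI-1 §2) the Coates–Wiles value through `ρ`
  have hMI := LubinTate.map_constantCoeff_iterate_invDiff_derivation_dlog_of_subst_of_log_compat (isUniformizer_unit_mul h2 u)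
    (B := ℂ_[2]) (algebraMap (LTCoeff (v.adicCompletion K)) (unitBall E)) ρ (by rw [hρ, halg]) k Gβ G hH hGβ' hΛ0 hΛ1
    (b := φF (((LTCoeff.of (v.adicCompletion K)).symm a : 𝒪[v.adicCompletion K]) : v.adicCompletion K))
    (by rw [halg] at hcompat; rw [hρ]; exact hcompat) Ge hGe
  rw [hMI]
  -- the complex unit `Pe = (Q_R^{φ_ℂ}) ∘ exp_{W_ℂ} = P`, the Taylor series of `Θ(Ω − z; L, L′, S)`
  set QC : PowerSeries ℂ := PowerSeries.map φC (C Kc * ∏ c ∈ S.erase 0,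
    PowerSeries.invOfUnit ((WR.translateX x₀ y₀).subst WR.formalNeg - C (x c)) (uc c) ^ 6) with hQC
  have hPtaylor : (PowerSeries.mk fun n => ((Nat.factorial n : ℂ))⁻¹ * iteratedDeriv n (fun w => L.deShalitTheta L' S (Ω - w)) 0) =
      QC.subst WC.formalExp :=
    WR.taylor_deShalitTheta_sub_eq_map_subst_formalExp x₀ y₀ x uc Kc φC WC L hS hg₂ hg₃ hΩ hV ha hb hK hx hu
  have hPe_unit : IsUnit (QC.subst WC.formalExp) := by
    rw [PowerSeries.isUnit_iff_constantCoeff, ← hPtaylor]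
    exact (PeriodPair.constantCoeff_taylor_deShalitTheta_ne_zero hS hΩ).isUnit
  have hQC0 : PowerSeries.constantCoeff QC ≠ 0 := by
    rw [hQC, ← PowerSeries.coeff_zero_eq_constantCoeff_apply, PowerSeries.coeff_map, PowerSeries.coeff_zero_eq_constantCoeff_apply,
      WR.map_constantCoeff_thetaTExpansion_eq_deShalitTheta x₀ y₀ x uc Kc φC WC L ha hK hx hu]
    exact PeriodPair.deShalitTheta_ne_zero hS hΩ
  have hQC_unit : IsUnit QC := PowerSeries.isUnit_iff_constantCoeff.mpr hQC0.isUnit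
  -- functoriality (MI-2 §1) along `τ : ℂ → ℂ₂`: `Ge = (QC-unit)^τ ∘ exp_{W_ℂ^τ}`
  have hGmap : (G : PowerSeries (unitBall E)).map ρ = QC.map τ := by
    rw [hG, ← RingHom.comp_apply (PowerSeries.map ρ) (PowerSeries.map ψ𝔓), ← PowerSeries.map_comp, hQθ, hQC,
      ← RingHom.comp_apply (PowerSeries.map τ) (PowerSeries.map φC), ← PowerSeries.map_comp]
  have hW₂ : WC.map τ = W₂ := by rw [← hV, hW, hW₂, halg]
  have hGe' : (Ge : PowerSeries ℂ_[2]) =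
      PowerSeries.subst (WC.map τ).formalExp (PowerSeries.map τ ((hQC_unit.unit : (PowerSeries ℂ)ˣ) : PowerSeries ℂ)) := by
    rw [hGe, hGmap, IsUnit.unit_spec, hW₂, WeierstrassCurve.formalExp_eq_substInvOfIsUnit]
  have hfun := WeierstrassCurve.factorial_mul_coeff_dlog_units_subst_formalExp_map τ WC hQC_unit.unit hPe_unit.unit Ge
    (by rw [IsUnit.unit_spec, IsUnit.unit_spec]) hGe' k
  have hval := WR.factorial_mul_coeff_dlog_units_map_thetaTExpansion_subst_formalExp x₀ y₀ x uc Kc φC WC L hS hg₂ hg₃ hΩ hV ha hb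
    hK hx hu hPe_unit.unit (by rw [IsUnit.unit_spec]) k
  rw [hτapp]
  calc (k.factorial : ℂ_[2]) * (φF (((LTCoeff.of (v.adicCompletion K)).symm a : 𝒪[v.adicCompletion K]) : v.adicCompletion K) ^ (k + 1) *
        PowerSeries.coeff k (PowerSeries.dlog Ge))
      = φF (((LTCoeff.of (v.adicCompletion K)).symm a : 𝒪[v.adicCompletion K]) : v.adicCompletion K) ^ (k + 1) *
          ((k.factorial : ℂ_[2]) * PowerSeries.coeff k (PowerSeries.dlog Ge)) := by ring
    _ = φF (((LTCoeff.of (v.adicCompletion K)).symm a : 𝒪[v.adicCompletion K]) : v.adicCompletion K) ^ (k + 1) *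
          τ (-12 * ((S.card : ℂ) * L.eisensteinE (k + 1) Ω - L'.eisensteinE (k + 1) Ω)) := by rw [hfun, hval]

set_option maxHeartbeats 1600000 in
/-- ★★★ **`hΦ` FROM THE BRIDGE — the FROBENIUS IMAGE `φ(c_β)`** (de Shalit II §4.10 (26) for the conjugate unit, II §4.14 (38)): with the
bridge identity (hβ) `g_β = (G ∘ [1]_{P′,f}) ∘ [a]_f` and (hGφ) `G^φ = Q_R^{ψ_𝔓}` — the `φ`-CONJUGATE of `G` is the theta `t`-expansion of the data
`(x₀, y₀, x_c, K)` over `R` whose complex reading is `(L, L′, S, Ω)` — and (hQθ), (hW) as in `map_relCoatesWiles_eq_of_bridge`: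
`ρ(φ([X⁰] D_E^[k] (δ_E g_β))) = φ_F(a)^{k+1} · ι⁻¹(−12·(#S·E_{k+1}(Ω, L) − E_{k+1}(Ω, L′)))`.
(`D_E`, `δ_E` commute with `φ`; `φ` fixes `[1]_{P′,f}`, `[a]_f`.) [cite: deShalit1987, II §4.5 (iv) (p. 57), II §4.10 (26) (p. 64), II §4.14 (38) (p. 71)] -/
theorem map_frob_relCoatesWiles_eq_of_bridge
    (hq : residueFieldCard (v.adicCompletion K) = 2)
    (h2 : (valuation (v.adicCompletion K)).IsUniformizer ((((2 : ℕ) : 𝒪[v.adicCompletion K]) : v.adicCompletion K)))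
    (u : 𝒪[v.adicCompletion K]ˣ)
    (E : IntermediateField (v.adicCompletion K) (AlgebraicClosure (v.adicCompletion K)))
    [FiniteDimensional (v.adicCompletion K) E] [Normal (v.adicCompletion K) E] [IsGalois (v.adicCompletion K) E]
    (hE : E ≤ maxUnramified (v.adicCompletion K))
    {σ₀ : absoluteGaloisGroup (v.adicCompletion K)} (hσ₀ : IsAbsArithFrob σ₀)
    (β : RelNormCoherentUnits (isUniformizer_unit_mul h2 u) E) (k : ℕ)
    (ρ : unitBall E →+* ℂ_[2]) (φF : v.adicCompletion K →+* ℂ_[2])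
    (hρ : ρ.comp (algebraMap (LTCoeff (v.adicCompletion K)) (unitBall E)) =
      φF.comp ((algebraMap 𝒪[v.adicCompletion K] (v.adicCompletion K)).comp (LTCoeff.of (v.adicCompletion K)).symm.toRingHom))
    (ιp : PadicAlgCl 2 ≃+* ℂ)
    (V : WeierstrassCurve ℤ_[2]) {c : ℤ_[2]} {P : PowerSeries ℤ_[2]}
    (hP : P.map PadicInt.Coe.ringHom =
      (V.map PadicInt.Coe.ringHom).formalExp.subst (C (c : ℚ_[2]) * (V.map PadicInt.Coe.ringHom).formalLog))
    (heπ : ((integerEquivAdicCompletionIntegers v).trans (padicIntEquivOfDegreeOne K 2 v he hf))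
      ((u : 𝒪[v.adicCompletion K]) * ((2 : ℕ) : 𝒪[v.adicCompletion K])) = c)
    (hP' : IsLTSeries (LTCoeff.of (v.adicCompletion K) ((u : 𝒪[v.adicCompletion K]) * ((2 : ℕ) : 𝒪[v.adicCompletion K])))
      (residueFieldCard (v.adicCompletion K))
      (P.map ((LTCoeff.of (v.adicCompletion K)).toRingHom.comp
        ((integerEquivAdicCompletionIntegers v).trans (padicIntEquivOfDegreeOne K 2 v he hf)).symm.toRingHom)))
    (a : LTCoeff (v.adicCompletion K)) (G : (PowerSeries (unitBall E))ˣ)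
    (hβ : relColemanSeries (isUniformizer_unit_mul h2 u) E hq hE hσ₀ β =
      PowerSeries.subst ((hom (isLTRing_LTCoeff (isUniformizer_unit_mul h2 u)) (isLTSeries_LTCoeff _) (isLTSeries_LTCoeff _) a).map
          (algebraMap (LTCoeff (v.adicCompletion K)) (unitBall E)))
        (PowerSeries.subst ((hom (isLTRing_LTCoeff (isUniformizer_unit_mul h2 u)) hP' (isLTSeries_LTCoeff _) 1).map
          (algebraMap (LTCoeff (v.adicCompletion K)) (unitBall E))) (G : PowerSeries (unitBall E))))
    {R : Type*} [CommRing R] (WR : WeierstrassCurve R) (x₀ y₀ : R) (x : ℂ → R) (uc : ℂ → Rˣ) (Kc : R) (φC : R →+* ℂ)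
    (WC : WeierstrassCurve ℂ) (L : PeriodPair) {L' : PeriodPair} {S : Finset ℂ} {Ω : ℂ}
    (hS : L.IsLatticeReps L' S) (hg₂ : L.g₂ = WC.c₄ / 12) (hg₃ : L.g₃ = WC.c₆ / 216) (hΩ : Ω ∉ L'.lattice) (hV : WR.map φC = WC)
    (ha : φC x₀ = ℘[L] Ω - WC.b₂ / 12) (hb : φC y₀ = (℘'[L] Ω - WC.a₁ * (℘[L] Ω - WC.b₂ / 12) - WC.a₃) / 2)
    (hK : φC Kc = L.deltaRatio L' * (L.g₂ ^ 3 - 27 * L.g₃ ^ 2) ^ (S.card - 1))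
    (hx : ∀ c ∈ S.erase 0, φC (x c) = ℘[L] c - WC.b₂ / 12) (hu : ∀ c ∈ S.erase 0, (uc c : R) = x₀ - x c)
    (ψ𝔓 : R →+* unitBall E)
    (hGφ : PowerSeries.map (frobUnitBall E σ₀ : unitBall E →+* unitBall E) (G : PowerSeries (unitBall E)) =
      PowerSeries.map ψ𝔓 (C Kc * ∏ c ∈ S.erase 0,
        PowerSeries.invOfUnit ((WR.translateX x₀ y₀).subst WR.formalNeg - C (x c)) (uc c) ^ 6))
    (hQθ : ρ.comp ψ𝔓 = ((algebraMap (PadicAlgCl 2) ℂ_[2]).comp ιp.symm.toRingHom).comp φC)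
    (hW : (WR.map φC).map ((algebraMap (PadicAlgCl 2) ℂ_[2]).comp ιp.symm.toRingHom) =
      (V.map (((padicEquivOfDegreeOne K 2 v he hf).symm.toRingHom).comp (PadicInt.Coe.ringHom (p := 2)))).map φF) :
    ρ ((frobUnitBall E σ₀ : unitBall E →+* unitBall E) (PowerSeries.constantCoeff ((fun g : PowerSeries (unitBall E) =>
        (invDiff (isLTRing_LTCoeff (isUniformizer_unit_mul h2 u))
            (isLTSeries_LTCoeff ((u : 𝒪[v.adicCompletion K]) * ((2 : ℕ) : 𝒪[v.adicCompletion K])))).map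
            (algebraMap (LTCoeff (v.adicCompletion K)) (unitBall E)) *
          PowerSeries.derivative (unitBall E) g)^[k] (relLogDerivSeries (isUniformizer_unit_mul h2 u) E hq hE hσ₀ β)))) =
      (φF (((LTCoeff.of (v.adicCompletion K)).symm a : 𝒪[v.adicCompletion K]) : v.adicCompletion K)) ^ (k + 1) *
        ((ιp.symm (-12 * ((S.card : ℂ) * L.eisensteinE (k + 1) Ω - L'.eisensteinE (k + 1) Ω)) : PadicAlgCl 2) : ℂ_[2]) := by
  have hφA : ∀ a' : LTCoeff (v.adicCompletion K), (frobUnitBall E σ₀ : unitBall E →+* unitBall E)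
      (algebraMap (LTCoeff (v.adicCompletion K)) (unitBall E) a') = algebraMap (LTCoeff (v.adicCompletion K)) (unitBall E) a' :=
    frobUnitBall_algebraMap_LTCoeff E σ₀
  have hφc : (frobUnitBall E σ₀ : unitBall E →+* unitBall E).comp (algebraMap (LTCoeff (v.adicCompletion K)) (unitBall E)) =
      algebraMap (LTCoeff (v.adicCompletion K)) (unitBall E) := RingHom.ext hφA
  rw [← PowerSeries.coeff_zero_eq_constantCoeff_apply, ← PowerSeries.coeff_map,
    map_frob_iterate_relDerivation (isUniformizer_unit_mul h2 u) E, PowerSeries.coeff_zero_eq_constantCoeff_apply, relLogDerivSeries,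
    ← relLogDeriv_map (isUniformizer_unit_mul h2 u) hφA, relLogDeriv_def (isUniformizer_unit_mul h2 u) E]
  -- the conjugate unit `g_β^φ = (G^φ ∘ [1]_{P′,f}) ∘ [a]_f`
  refine map_constantCoeff_iterate_dlog_eq_of_bridge K v he hf h2 u E k ρ φF hρ ιp V hP heπ hP' a _
    (Units.map (PowerSeries.map (frobUnitBall E σ₀ : unitBall E →+* unitBall E)).toMonoidHom G) ?_
    WR x₀ y₀ x uc Kc φC WC L hS hg₂ hg₃ hΩ hV ha hb hK hx hu ψ𝔓 (by rw [Units.coe_map, RingHom.toMonoidHom_eq_coe,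
      MonoidHom.coe_coe, hGφ]) hQθ hW
  change PowerSeries.map (frobUnitBall E σ₀ : unitBall E →+* unitBall E)
      ((isUnit_relColemanSeries (isUniformizer_unit_mul h2 u) E hq hE hσ₀ β).unit : PowerSeries (unitBall E)) =
    PowerSeries.subst _ (PowerSeries.subst _
      (PowerSeries.map (frobUnitBall E σ₀ : unitBall E →+* unitBall E) (G : PowerSeries (unitBall E))))
  rw [IsUnit.unit_spec, hβ, LubinTate.map_subst_map_algebraMap_of_comp_eq _ hφc (constantCoeff_hom _ _ _ _),
    LubinTate.map_subst_map_algebraMap_of_comp_eq _ hφc (constantCoeff_hom _ _ _ _)]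

end Summit.BirchSwinnertonDyer.BirchSwinnertonDyer.Theorems.PrintCf2.KatzMeasureJZeroSeam

end
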